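import Summits.QuantumFields.YangMills.Theorems.BalabanUVNodesRateCarriersOfRecord13CoPHOn
import Summits.QuantumFields.YangMills.Theorems.BalabanUVNodesN16AtRRec12OfRecord
import Summits.QuantumFields.YangMills.Theorems.BalabanUVNodesN16AtTupleReadingBinderGeneric

/-!
# Route «BalabanUVNodes», cluster K4 «SpineRates» — node N16 = NE3 AT NODE 00's STAGE-13 RATE HOMES `RRec₁₃CoPH 𝔯` AND `RRec₁₃CoPHOn 𝔯 Rg`: the N16 side of the Record-13
# re-key in ONE module — instance certificates, the knit in guarded θ-form, transfers between the two homes, N21's faces, «THE TWO HOMES AGREE AT A CONSTANT NE3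
# LAYER», the stub from `LeafSlot` ALONE at RR-1's NE3 object of record with tuned letters (`hpin`-generic), and the junk tests

CoPH EDITION (FINDING №9 = node00-def-T LOCATED-9 «history-blind residual 𝐓-weight slot»; director-ym №183 H1ʰ ∕ №186 (α) ∕ №190 PRESS WORD; node00-def-T FILE 27 `Node00/Record13CoPH.lean`
p537939 + FILE 28T `Node00/Record13SepCoPH.lean` p539169, T₇ = KEY-RULE-27 ∕ `KEYMAP-Record13-v1.7.md`; plan rev 24; dag-lead DEDUP-301 «v1.7 porters UNGATED → GO» ∕ DEDUP-302 — 2026-08-27):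
RECORD 13 v1.7 indexes the residual 𝐓-weight slot by the WHOLE history — `structure Stage13HParams … extends Stage13RParams` with the fields `Zh : (p : B12.RunParams) → ℕ →
(ℕ → Set (Site (Fam.P p.K) 0)) → (ℕ → Set (Site (Fam.P p.K) 0)) → TkResidualW Fam N (FluctV N) p.K` and `Phih`, readers `zhAt ∕ rzAt`, guard `Stage13HParams.ZhUnity`, proviso
`Stage13HParams.Provisos₁₃CoPH` (rows `zhLaws ∕ zhLocal`), `towerOfRecord₁₃CoPH ∕ datumOfRecord₁₃CoPH`, record class `IsRecordOfRecord₁₃CCoPH`, door `Stage13HParams.ofHistoryBlind`; node00-def-RR-2's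
key `Node00/Record13DatumKeyCoPH` p539151 (`IsDatumOfRecord₁₃CCoPH(On∕N)`, `.params ∕ .provisos ∕ .admissible`, `isDatumOfRecord₁₃CCoPH_datumOfRecord₁₃CoPH`, guard of record `unityNondeg₁₃H`) and
dag-n22-e's (T-RATE) layer-B ∕ reading-of-record CoPH ports (`RateReading₁₃CoPH`, `rateCarriersOfRecord₁₃CoPH`, `RRec₁₃CoPH`, `RRec₁₃CoPHOn`, `readingOfRecord₁₃CoPH`, …) followed; the items re-key to
⁷ (`…R13SepCoPH`, plan rev 24 ∕ dag-lead WORDS-143), bg-blind consumer storeys port their OWN files (director-ym №174 (3) standing).  THIS FILE is the TOKEN TWIN of this seat's v1.6 module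
`…N16AtRRec13CoPR` (p535311) under T₇: binder `(θ : Stage13RParams F N) ↦ (θ : Stage13HParams F N)` (regimes `Rg`, run-length selectors `ksel`, tuple readings `rr` re-typed
with it; `θ.Admissible F N` read through the ancestor structures), `Provisos₁₃CoPR ↦ Provisos₁₃CoPH`, every `…CoPR…` record ∕ key ∕ home ∕ reading ∕ module stem `↦ …CoPH…`, guard
`unityNondeg₁₃R ↦ unityNondeg₁₃H` (prose only here) — statements = the v1.6 statements under that map; proofs VERBATIM; θ-free names (RR-1's `ne3ConstLayerOfRecord₁₁` ∕ `ne3NperOfRecord₁₁` ∕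
`ne3DomOfRecord₁₁`, `InEndRegime`, `LeafSlot`, the AT slots, dag-n16-c's β-kit, …) VERBATIM; stage-free lemmas NOT re-declared (imported BY NAME); N16 reads no field of the key (no `Zh ∕ Zr ∕
Zt`, no `bg`, no transport face — T₇'s SITE RULE S₇ has no site in this file); the tuple-currency (K3 `KeyedRates rr`) conjuncts are CITED from this seat's BINDER-GENERIC modules
`…N16AtTupleReadingBinderGeneric` ∕ `…N16HolderMSAtTupleReadingBinderGeneric` (p530924 ∕ p531947: key type, proviso and admissibility are variables — NO port needed at this or any
later edition).  NOTE (LOCATED-4∕5 of dag-n16-e ∕ dag-n16-c): every «THE N16 LINE» keyed on the law-free univ sub-family is VACUOUS as stated (n16-c F49); the LIVE lines carry N05's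
conjunct at the pinned all-torus proper sub-index (`…AllTorusAtRecord13CoPH`).  The v1.6 CoPR ∕ v1.5 CoP ∕ Co ∕ ⁗ ∕ ‴ siblings and the item ids they name are ASIDES; the lane is
K3⁷ `SpineGivenEndpointR13SepCoPH` = stmt-QuantumFields-20544 (plan g73 REV24-BORN l.20848; dag-lead WORDS-143),
filed `--kind proof --supports stmt-QuantumFields-20544 --as helper`.

Cell `pub-ymgap`, seat `pub-ymgap-dag-n16-e` (R134 acceleration seat (a), strategy s2 = BY-NAME KNIT at the record; HUMAN RULING D-0062; chair R424 venue),
generation 8, module 19ᴴ (THEOREMS ONLY, 0 `def`, 0 `sorry`).  `bears_on: R4∕N16 · K1‴ StabilityBAtRecordR13e (stmt-QuantumFields-19910, the N16 storey's lane per dag-lead's KEY TABLE WORDS-133) · K3‴ SpineGivenEndpointR13 (stmt-QuantumFields-19912)`.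
The 12 ↦ 13 TOKEN TWIN of this seat's Stage-12 files 6 `…N16AtRRec12` (p466499), 8 `…N16AtRRec12ConstLayer` (p467313), 11 `…N16AtRRec12OfRecord` (p470038 ∕ p472645)
and 12 `…N16AtRRec12On` (p474753), consolidated by topic (D-0064: one file per section).  Imports the (T-RATE) Stage-13 regime-restricted home
`BalabanUVNodesRateCarriersOfRecord13CoPHOn` (`RRec₁₃CoPHOn 𝔯 Rg := fun F D g₀ os R => ∃ θ hP, Rg F θ ∧ θ.Admissible F N ∧ D = datumOfRecord₁₃CoPH F N θ hP ∧ ∃ k, R =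
rateCarriersOfRecord₁₃CoPH 𝔯 F θ hP g₀ os k`, master faces `s_N16_rRec₁₃CoPHOn_iff` ∕ `s_N16_rRec₁₃CoPH_iff`, `rRec₁₃CoPH_self`, `rRec₁₃CoPHOn_self`, `RRec₁₃CoPHOn.isDatumOfRecord₁₃CCoPH`,
`k4_rRec₁₃CoPHOn_anti`, `k4_rRec₁₃CoPH_of_rRec₁₃CoPHOn_true`, `rRec₁₃CoPHOn_of_regime_params`; through it the canonical home `RRec₁₃CoPH 𝔯` over node00-def-RR-2's key `Node00/Record13DatumKeyCoPH`
and node00-def-T's `Node00/Record13` v1.1) and this seat's Stage-12 file 11 for the STAGE-FREE proviso lemma `inEndRegime_ofRecord_of_letters` (through it files 1–10: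
`InEndRegime`, `PrintSlot`, `LeafSlot`, `radiusOfRecord`, `constOfRecord`, the closers, the stage-generic keyed-home interface `…N16AtKeyedHome`, RR-1's
`Node00/RateRecord11NE3Data`).  Restates nothing; cites by name.

WHY (pub-ymgap INBOX l.15699 ∕ l.15735, 2026-08-27; this seat's g4 HANDOFF trigger t3″ «Record-13 re-key»).  director-ym LINE №125 «RECORD 13» ⇒ node00-def-T's
`Node00/Record13.lean` (p486037 + v1.1 p488788: `Stage13Params extends Stage12Params` by the χ^{(2.9)} width `ε₂₉`; `Provisos₁₃CoPH.bg` ranged; β of record over the canonical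
transport `TcanOfRecord`), RR-2's key `Node00/Record13DatumKeyCoPH` and the (T-RATE) ₁₃ homes; plan rev 16∕17 re-filed K0‴–K3‴ over `Stage13HParams F 2` (ids 19909–19912), and the K3‴ composer
reads `h16 : S_N16 (RRec₁₃CoPHOn 𝔯 (unityNondeg₁₃H 2))` (or, in the skeleton's own currency, module 21's N16 conjunct of `KeyedRates rr`).  N16's exposure to the re-key is EXACTLY the home's NAME: its reading of record is RR-1's θ-FREE constant layer
`ne3ConstLayerOfRecord₁₁ F N (ℓ F)` (stage-free container), it reads no field of `Stage13HParams` ∕ `Provisos₁₃CoPH` (`.bg`-blind, `ε₂₉`-blind, no β token, no transport face —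
RR-2's `R13-KEY-TOKEN-MAP.md` §3 spots 1–3 do not touch N16), and every CONTENT lemma of the N16 line is already home-free in the tree.  So this module is bookkeeping:
the same theorems at the new home, `Rg`-generic (the K3‴ composer instantiates `N = 2`, `Rg = unityNondeg₁₃H 2`; every smaller or larger regime is served by §3).

CONTENT.
§1 CERTIFICATES — `admits_rRec₁₃CoPH` ∕ `attains_rRec₁₃CoPH`: `RRec₁₃CoPH 𝔯` admits and attains exactly the literals of its reading (the stage-generic interface of file 5
   `…N16AtKeyedHome` instantiated; the re-key costs N16 these two 3-line theorems, as announced there).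
§2 THE KNIT, GUARDED θ-FORM — `s_N16_rRec₁₃CoPHOn_of_inEndRegime_leafSlot` (proviso `InEndRegime` ∧ `LeafSlot` at the reading's NE3 bundle for every admissible θ with provisos IN
   `Rg`, along every `(g₀, os, k)` ⇒ `S_N16 (RRec₁₃CoPHOn 𝔯 Rg)`), `n16At_of_s_N16_rRec₁₃CoPHOn` (the read-out), and the R422 HONESTY FACE `s_N16_rRec₁₃CoPHOn_of_guard_empty` (no guarded
   admissible tuple ⇒ the stub holds VACUOUSLY: `S_N16 (RRec₁₃CoPHOn 𝔯 Rg)` carries content exactly on the guarded admissible tuples — their existence at the guard of record is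
   K0‴, OPEN).
§3 TRANSFERS — `s_N16_rRec₁₃CoPHOn_anti` (antitone in `Rg`), `s_N16_rRec₁₃CoPHOn_of_rRec₁₃CoPHOn_true`, `s_N16_rRec₁₃CoPH_of_rRec₁₃CoPHOn_true`, `s_N16_rRec₁₃CoPH_of_rRec₁₃CoPHOn_of_regime_params`.
§4 N21's FACES — `covRoot_rRec₁₃CoPHOn` (under the stub, `NE3EnergyRateWCov 4 (sfClass 4 L o.Nper o.ε) L o.Nper o.b o.g o.C o.Λ₁ o.Λ₂' o.dom`, `L = ne3LOfRecord₁₁ F`,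
   `o = (𝔯.lit F θ hP g₀ os).ne3 k`, at every guarded admissible tuple and run length) and `covRoot_rRec₁₃CoPH` (the same at every Stage-13 datum key, via `covRoot_of_attains`).
§5 CONSTANT NE3 LAYERS (`(𝔯.lit F θ hP g₀ os).ne3 k = o F`) — canonical home: `n16At_of_s_N16_rRec₁₃CoPH_constLayer` (= dag-n21-d's `h16`), `s_N16_rRec₁₃CoPH_iff_of_constLayer`,
   `s_N16_rRec₁₃CoPH_of_constLayer_leafSlot`; regime-restricted home: `s_N16_rRec₁₃CoPHOn_iff_of_constLayer` (`S_N16 (RRec₁₃CoPHOn 𝔯 Rg) ↔ ∀ F, (∃ θ, θ.Provisos₁₃CoPH F N ∧ Rg F θ ∧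
   θ.Admissible F N) → N16At (ne3OfRecord₁₁ F (o F))`), `n16At_of_s_N16_rRec₁₃CoPHOn_constLayer`, `s_N16_rRec₁₃CoPHOn_of_constLayer(_leafSlot)`; THE TWO HOMES AGREE:
   `s_N16_rRec₁₃CoPHOn_of_s_N16_rRec₁₃CoPH_constLayer` (`S_N16 (RRec₁₃CoPH 𝔯) → S_N16 (RRec₁₃CoPHOn 𝔯 Rg)`, EVERY `Rg`), `s_N16_rRec₁₃CoPHOn_true_iff_s_N16_rRec₁₃CoPH_constLayer`.
§6 AT RR-1's NE3 OBJECT OF RECORD `ne3ConstLayerOfRecord₁₁ F N (ℓ F)` (`hpin`-generic; at a NAMED Stage-13 reading of record `hpin := fun … => rfl`) —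
   `s_N16_rRec₁₃CoPHOn_iff_ofRecord`, `s_N16_rRec₁₃CoPHOn_ofRecord_of_leafSlot`, **`s_N16_rRec₁₃CoPHOn_ofRecord_of_letters_of_leafSlot`** (letters `⟨r, b F, g F, C F, r, Λ₂' F⟩` inside THE
   END's tolerance — `0 < g F`, `0 ≤ b F ≤ r∕2`, `Cof (g F) ≤ C F`: `LeafSlot` at ONE bundle per guarded family ⇒ the stub; proviso by file 11's
   `inEndRegime_ofRecord_of_letters`).  NO canonical-letter (`ε = r`) instance (this seat's g4 LOCATED-3: idle); the windowed-letter N16 LINES at ₁₃ are module 20.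
§6b THE TWO ₁₃ CURRENCIES AGREE — `s_N16_rRec₁₃CoPHOn_iff_n16_tupleReadingOn_ofRecord` ∕ `s_N16_rRec₁₃CoPH_iff_n16_tupleReading_ofRecord`: the home-keyed stub ↔
   module 21's N16 conjunct of the K3‴ skeleton's `KeyedRates rr` at a tuple reading, both pinned at RR-1's object (one `Iff.trans`).
§7 — the ‴ module's junk tests are NOT re-typed at the CoPH homes (400-line cap; same proofs apply).

HONEST FRAMING.  Kernel bookkeeping by name; no estimate; `InEndRegime` (THE END's thresholds), `PrintSlot` ([Balaban1985RegularSpaces] Theorem 4 in the all-torus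
geometry at the record's pairs — N05's) and `LeafSlot` (N05's typed leaf clauses on the univ sub-family of `zdGF3` + N07's [Balaban1985Variational] Thm 1 (8)+(10)
`LeafH3sup`) remain HYPOTHESES, proved nowhere in the tree; the reading `𝔯` is a PARAMETER; no admissible Stage-13 tuple with provisos in any regime is claimed to exist
(K0‴ over `Stage13HParams` OPEN) — by §2's honesty face the stub is VACUOUS where none exists; no ₁₂ ↔ ₁₃ bridge is stated (RR-2's map §3.2: the histories differ);
LOCATED (this seat, g2): N16's `sfClass`∕`IsMinimiser` world averages with [Balaban1985Averaging] (42), the record with [Balaban1987RG1] (0.4) — the transfer sits in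
N21's displayed `hdict`, not here; LOCATED-N16-HÖLDER-PIN (dag-n16-c; R-β unruled) untouched — the exponent-β twins are module 20; **N16 ∕ NE3 is NOT discharged**;
count-neutral; one finite four-torus at fixed ε — NOT ℝ⁴, NOT infinite volume, NOT OS, NOT a mass gap, NOT Clay.
-/

set_option autoImplicit false

open scoped BigOperators Matrix Matrix.Norms.L2Operator
open NormedSpace

namespace Summit.QuantumFields.YangMills.BalabanUVNodes.N16AtRRec13CoPH

open Literature.MathematicalPhysics.QuantumFieldTheory.Balaban1983to89
open Literature.MathematicalPhysics.QuantumFieldTheory.Balaban1983to89.T4Continuum (T4Family ULoop)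
open B7Prop1Explicit B7Prop2Explicit
open T4AveragingDeficitWallBoundary (IsPeriodicCfg)
open Node00 (IsDatumOfRecord₁₃CCoPH Stage13HParams datumOfRecord₁₃CoPH NE3Objects₁₁ NE3Letters₁₁ NE2Objects₁₁ ne3LOfRecord₁₁ ne3ConstLayerOfRecord₁₁ ne3NperOfRecord₁₁
  ne3DomOfRecord₁₁ nonempty_rateObjects₁₁)
open Summit.QuantumFields.BalabanUV.T4Continuum
open MinimalActionRate (sfClass)
open MinimalActionRefine (gradConst)
open MinimalActionWitness (flatCfg)
open NE3EnergyShapes (IsUnitarySite)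
open NE3EnergyWeightedCovShape (NE3EnergyRateWCov)
open NE1p.DressedRoot (growingTower)
open YMDAG.UVSplit (Datum NE3Carriers NE1pCarriers RateCarriers RateRecordPred N16At S_N16 ne3OfRecord₁₁ RateReading₁₃CoPH rateCarriersOfRecord₁₃CoPH RRec₁₃CoPH RRec₁₃CoPHOn
  rRec₁₃CoPH_self s_N16_rRec₁₃CoPH_iff rRec₁₃CoPHOn_self s_N16_rRec₁₃CoPHOn_iff k4_rRec₁₃CoPHOn_anti k4_rRec₁₃CoPH_of_rRec₁₃CoPHOn_true rRec₁₃CoPHOn_of_regime_params)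
open Summit.QuantumFields.YangMills.BalabanUVNodes.N16Regime (PrintSlot InEndRegime radiusOfRecord constOfRecord n16At_of_inEndRegime_printSlot)
open Summit.QuantumFields.YangMills.BalabanUVNodes.N16LeafSlot (LeafSlot n16At_of_inEndRegime_leafSlot)
open Summit.QuantumFields.YangMills.BalabanUVNodes.N16AtRateRecord11 (n16At_ne3Objects_flatDom)
open Summit.QuantumFields.YangMills.BalabanUVNodes.N16AtKeyedHome (covRoot_of_attains not_s_N16_of_pins_negLip)
open Summit.QuantumFields.YangMills.BalabanUVNodes.N16AtRRec12OfRecord (inEndRegime_ofRecord_of_letters)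

noncomputable section

variable {N : ℕ} [NeZero N] (𝔯 : RateReading₁₃CoPH N) (Rg : (F : T4Family) → Stage13HParams F N → Prop)

/-! ## §1 The Stage-13 instance certificates of the stage-generic keyed-home interface (file 5 `…N16AtKeyedHome`) -/

/-- **`RRec₁₃CoPH 𝔯` ADMITS only the literals of its reading** (`key := IsDatumOfRecord₁₃CCoPH`, `ne3At h g₀ os k := (𝔯.lit F h.params h.provisos g₀ os).ne3 k`; `rfl` on the
bundle's NE3 component). [folklore] -/
theorem admits_rRec₁₃CoPH (F : T4Family) (D : Datum F N) (g₀ : ℕ → ℝ) (os : List (ULoop F)) (R : RateCarriers N) (hR : RRec₁₃CoPH 𝔯 F D g₀ os R) :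
    ∃ (h : IsDatumOfRecord₁₃CCoPH F N D) (k : ℕ), R.ne3 = ne3OfRecord₁₁ F ((𝔯.lit F h.params h.provisos g₀ os).ne3 k) := by
  obtain ⟨h, k, rfl⟩ := hR
  exact ⟨h, k, rfl⟩

/-- **`RRec₁₃CoPH 𝔯` ATTAINS every literal of its reading** (witness: the run-length-`k` bundle at the canonical parameter with its provisos, layer B's `rRec₁₃CoPH_self`).
[folklore] -/
theorem attains_rRec₁₃CoPH (F : T4Family) (D : Datum F N) (h : IsDatumOfRecord₁₃CCoPH F N D) (g₀ : ℕ → ℝ) (os : List (ULoop F)) (k : ℕ) :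
    ∃ R : RateCarriers N, RRec₁₃CoPH 𝔯 F D g₀ os R ∧ R.ne3 = ne3OfRecord₁₁ F ((𝔯.lit F h.params h.provisos g₀ os).ne3 k) :=
  ⟨rateCarriersOfRecord₁₃CoPH 𝔯 F h.params h.provisos g₀ os k, rRec₁₃CoPH_self 𝔯 h g₀ os k, rfl⟩

/-! ## §2 The knit at the regime-restricted home — guarded θ-form; the read-out; the honesty face -/

/-- **THE KNIT AT THE REGIME-RESTRICTED STAGE-13 HOME, LEAF FORM**: if for every family, every admissible Stage-13 tuple `θ` with provisos `hP` IN THE REGIME `Rg F θ`,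
every `(g₀, os)` and run length `k` the reading's NE3 bundle `ne3OfRecord₁₁ F ((𝔯.lit F θ hP g₀ os).ne3 k)` satisfies the proviso `InEndRegime` (THE END's thresholds) and
carries `LeafSlot` (N05's typed leaf clauses on the univ sub-family of `zdGF3` + N07's `LeafH3sup`), then `S_N16 (RRec₁₃CoPHOn 𝔯 Rg)` — the (T-RATE) master face
`s_N16_rRec₁₃CoPHOn_iff` closed by `n16At_of_inEndRegime_leafSlot` once per bundle.  Neither hypothesis is asserted here. [folklore] -/
theorem s_N16_rRec₁₃CoPHOn_of_inEndRegime_leafSlot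
    (h : ∀ (F : T4Family) (θ : Stage13HParams F N) (hP : θ.Provisos₁₃CoPH F N), Rg F θ → θ.Admissible F N →
      ∀ (g₀ : ℕ → ℝ) (os : List (ULoop F)) (k : ℕ),
        InEndRegime (ne3OfRecord₁₁ F ((𝔯.lit F θ hP g₀ os).ne3 k)) ∧ LeafSlot (ne3OfRecord₁₁ F ((𝔯.lit F θ hP g₀ os).ne3 k))) :
    S_N16 (RRec₁₃CoPHOn 𝔯 Rg) :=
  (s_N16_rRec₁₃CoPHOn_iff 𝔯 Rg).2 fun F θ hP hRg hθ g₀ os k =>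
    n16At_of_inEndRegime_leafSlot (h F θ hP hRg hθ g₀ os k).1 (h F θ hP hRg hθ g₀ os k).2

/-- **THE READ-OUT**: under `S_N16 (RRec₁₃CoPHOn 𝔯 Rg)`, `N16At` at the reading's NE3 bundle of every guarded admissible tuple with provisos, `(g₀, os)` and run length
(the (T-RATE) master face, forward). [folklore] -/
theorem n16At_of_s_N16_rRec₁₃CoPHOn (hS : S_N16 (RRec₁₃CoPHOn 𝔯 Rg)) (F : T4Family) (θ : Stage13HParams F N) (hP : θ.Provisos₁₃CoPH F N) (hRg : Rg F θ)
    (hθ : θ.Admissible F N) (g₀ : ℕ → ℝ) (os : List (ULoop F)) (k : ℕ) : N16At (ne3OfRecord₁₁ F ((𝔯.lit F θ hP g₀ os).ne3 k)) :=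
  (s_N16_rRec₁₃CoPHOn_iff 𝔯 Rg).1 hS F θ hP hRg hθ g₀ os k

/-- **HONESTY FACE (R422): THE STUB AT THE REGIME-RESTRICTED HOME IS VACUOUS WHEN THE GUARD IS EMPTY** — if no family has an admissible Stage-13 tuple with provisos in
`Rg`, then `S_N16 (RRec₁₃CoPHOn 𝔯 Rg)` for EVERY reading, content-free.  The existence of a guarded admissible tuple (K0′ ∕ RR-2's CN key) is where the stub starts to bite
(the ‴ module §7's `exists_reading_not_s_N16_rRec₁₃On`, verbatim at the CoPH home). [folklore] -/
theorem s_N16_rRec₁₃CoPHOn_of_guard_empty (hempty : ∀ (F : T4Family) (θ : Stage13HParams F N), θ.Provisos₁₃CoPH F N → Rg F θ → ¬ θ.Admissible F N) :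
    S_N16 (RRec₁₃CoPHOn 𝔯 Rg) :=
  (s_N16_rRec₁₃CoPHOn_iff 𝔯 Rg).2 fun F θ hP hRg hθ _ _ _ => absurd hθ (hempty F θ hP hRg)

/-! ## §3 Transfers: antitone in the regime; to and from the canonical home -/

/-- **ANTITONE IN THE REGIME**: the stub over a larger regime gives the stub over every smaller one (the (T-RATE) face `k4_rRec₁₃CoPHOn_anti`, N16 cut). [folklore] -/
theorem s_N16_rRec₁₃CoPHOn_anti {Rg Rg' : (F : T4Family) → Stage13HParams F N → Prop} (h : ∀ F θ, Rg F θ → Rg' F θ) (hS : S_N16 (RRec₁₃CoPHOn 𝔯 Rg')) :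
    S_N16 (RRec₁₃CoPHOn 𝔯 Rg) :=
  (k4_rRec₁₃CoPHOn_anti 𝔯 h).2.2.1 hS

/-- **FROM THE TRIVIAL REGIME TO ANY REGIME.** [folklore] -/
theorem s_N16_rRec₁₃CoPHOn_of_rRec₁₃CoPHOn_true (hS : S_N16 (RRec₁₃CoPHOn 𝔯 fun _ _ => True)) : S_N16 (RRec₁₃CoPHOn 𝔯 Rg) :=
  s_N16_rRec₁₃CoPHOn_anti 𝔯 (fun _ _ _ => trivial) hS

/-- **TO THE CANONICAL HOME** `RRec₁₃CoPH 𝔯` from the trivial regime (the (T-RATE) face `k4_rRec₁₃CoPH_of_rRec₁₃CoPHOn_true`, N16 cut). [folklore] -/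
theorem s_N16_rRec₁₃CoPH_of_rRec₁₃CoPHOn_true (hS : S_N16 (RRec₁₃CoPHOn 𝔯 fun _ _ => True)) : S_N16 (RRec₁₃CoPH 𝔯) :=
  (k4_rRec₁₃CoPH_of_rRec₁₃CoPHOn_true 𝔯).2.2.1 hS

/-- **TO THE CANONICAL HOME FROM ANY REGIME CONTAINING THE CANONICAL PARAMETERS OF THE DATA OF RECORD** (the (T-RATE) face `rRec₁₃CoPHOn_of_regime_params`). [folklore] -/
theorem s_N16_rRec₁₃CoPH_of_rRec₁₃CoPHOn_of_regime_params (hreg : ∀ (F : T4Family) (D : Datum F N) (h : IsDatumOfRecord₁₃CCoPH F N D), Rg F h.params)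
    (hS : S_N16 (RRec₁₃CoPHOn 𝔯 Rg)) : S_N16 (RRec₁₃CoPH 𝔯) :=
  fun F D g₀ os R hR => hS F D g₀ os R (rRec₁₃CoPHOn_of_regime_params 𝔯 Rg hreg hR)

/-! ## §4 N21's faces at the two Stage-13 homes -/

/-- **N21's FACE AT THE REGIME-RESTRICTED STAGE-13 HOME** — under `S_N16 (RRec₁₃CoPHOn 𝔯 Rg)`, at every guarded admissible tuple with provisos, `(g₀, os)` and run length the
covariant root `NE3EnergyRateWCov 4 (sfClass 4 L o.Nper o.ε) L o.Nper o.b o.g o.C o.Λ₁ o.Λ₂' o.dom` holds, `L = ne3LOfRecord₁₁ F`, `o = (𝔯.lit F θ hP g₀ os).ne3 k` — the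
record decl `N16At` unfolded; what a regime-restricted N21 module reads as `hcov`. [folklore] -/
theorem covRoot_rRec₁₃CoPHOn (hS : S_N16 (RRec₁₃CoPHOn 𝔯 Rg)) (F : T4Family) (θ : Stage13HParams F N) (hP : θ.Provisos₁₃CoPH F N) (hRg : Rg F θ) (hθ : θ.Admissible F N)
    (g₀ : ℕ → ℝ) (os : List (ULoop F)) (k : ℕ) :
    NE3EnergyRateWCov 4
      (sfClass 4 (ne3LOfRecord₁₁ F) ((𝔯.lit F θ hP g₀ os).ne3 k).Nper ((𝔯.lit F θ hP g₀ os).ne3 k).ε) (ne3LOfRecord₁₁ F) ((𝔯.lit F θ hP g₀ os).ne3 k).Nper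
      ((𝔯.lit F θ hP g₀ os).ne3 k).b ((𝔯.lit F θ hP g₀ os).ne3 k).g ((𝔯.lit F θ hP g₀ os).ne3 k).C ((𝔯.lit F θ hP g₀ os).ne3 k).Λ₁ ((𝔯.lit F θ hP g₀ os).ne3 k).Λ₂'
      ((𝔯.lit F θ hP g₀ os).ne3 k).dom :=
  n16At_of_s_N16_rRec₁₃CoPHOn 𝔯 Rg hS F θ hP hRg hθ g₀ os k

/-- **N21's FACE AT THE CANONICAL STAGE-13 HOME `RRec₁₃CoPH 𝔯`** — under `S_N16 (RRec₁₃CoPH 𝔯)`, at every Stage-13 datum key `hD`, `(g₀, os)` and run length, the covariant root at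
`o = (𝔯.lit F hD.params hD.provisos g₀ os).ne3 k` (file 5's stage-generic `covRoot_of_attains` at the certificate `attains_rRec₁₃CoPH`). [folklore] -/
theorem covRoot_rRec₁₃CoPH (hS : S_N16 (RRec₁₃CoPH 𝔯)) (F : T4Family) (D : Datum F N) (hD : IsDatumOfRecord₁₃CCoPH F N D) (g₀ : ℕ → ℝ) (os : List (ULoop F)) (k : ℕ) :
    NE3EnergyRateWCov 4
      (sfClass 4 (ne3LOfRecord₁₁ F) ((𝔯.lit F hD.params hD.provisos g₀ os).ne3 k).Nper ((𝔯.lit F hD.params hD.provisos g₀ os).ne3 k).ε) (ne3LOfRecord₁₁ F)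
      ((𝔯.lit F hD.params hD.provisos g₀ os).ne3 k).Nper ((𝔯.lit F hD.params hD.provisos g₀ os).ne3 k).b ((𝔯.lit F hD.params hD.provisos g₀ os).ne3 k).g
      ((𝔯.lit F hD.params hD.provisos g₀ os).ne3 k).C ((𝔯.lit F hD.params hD.provisos g₀ os).ne3 k).Λ₁ ((𝔯.lit F hD.params hD.provisos g₀ os).ne3 k).Λ₂'
      ((𝔯.lit F hD.params hD.provisos g₀ os).ne3 k).dom :=
  covRoot_of_attains (key := fun F D => IsDatumOfRecord₁₃CCoPH F N D) (fun hD g₀ os k => (𝔯.lit _ hD.params hD.provisos g₀ os).ne3 k) (RRec₁₃CoPH 𝔯)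
    (attains_rRec₁₃CoPH 𝔯) hS F D hD g₀ os k

/-! ## §5 Constant NE3 layers — both homes; the two Stage-13 homes agree -/

section ConstLayer

variable (o : T4Family → NE3Objects₁₁ N)

/-- **UNDER THE STUB AT THE CANONICAL HOME, `N16At` AT THE ONE OBJECT OF EVERY FAMILY CARRYING A STAGE-13 DATUM OF RECORD** — the binder `h16 : N16At (ne3OfRecord₁₁ F o)`
of dag-n21-d's constant-layer N21 modules, read off `S_N16 (RRec₁₃CoPH 𝔯)` for a reading whose NE3 component is constantly `o F` (file 8's Stage-12 face, 12 ↦ 13). [folklore] -/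
theorem n16At_of_s_N16_rRec₁₃CoPH_constLayer
    (hconst : ∀ (F : T4Family) (θ : Stage13HParams F N) (hP : θ.Provisos₁₃CoPH F N) (g₀ : ℕ → ℝ) (os : List (ULoop F)) (k : ℕ), (𝔯.lit F θ hP g₀ os).ne3 k = o F)
    (hS : S_N16 (RRec₁₃CoPH 𝔯)) (F : T4Family) {D : Datum F N} (hD : IsDatumOfRecord₁₃CCoPH F N D) : N16At (ne3OfRecord₁₁ F (o F)) := by
  have h := (s_N16_rRec₁₃CoPH_iff 𝔯).1 hS F D hD (fun _ => 0) [] 0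
  rwa [hconst] at h

/-- **`S_N16 (RRec₁₃CoPH 𝔯)` IS «`N16At (ne3OfRecord₁₁ F (o F))` for every family carrying a Stage-13 datum of record»** for a constant-layer reading. [folklore] -/
theorem s_N16_rRec₁₃CoPH_iff_of_constLayer
    (hconst : ∀ (F : T4Family) (θ : Stage13HParams F N) (hP : θ.Provisos₁₃CoPH F N) (g₀ : ℕ → ℝ) (os : List (ULoop F)) (k : ℕ), (𝔯.lit F θ hP g₀ os).ne3 k = o F) :
    S_N16 (RRec₁₃CoPH 𝔯) ↔ ∀ (F : T4Family), (∃ D : Datum F N, IsDatumOfRecord₁₃CCoPH F N D) → N16At (ne3OfRecord₁₁ F (o F)) :=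
  ⟨fun hS F ⟨_, hD⟩ => n16At_of_s_N16_rRec₁₃CoPH_constLayer 𝔯 o hconst hS F hD, fun h16 => (s_N16_rRec₁₃CoPH_iff 𝔯).2 fun F D hD g₀ os k => by
    rw [hconst]
    exact h16 F ⟨D, hD⟩⟩

/-- **THE KNIT AT A CONSTANT LAYER, CANONICAL HOME, LEAF FORM**: the proviso `InEndRegime` and the leaf-form slot `LeafSlot` at the ONE bundle `ne3OfRecord₁₁ F (o F)` of every
family carrying a Stage-13 datum of record give `S_N16 (RRec₁₃CoPH 𝔯)`. [folklore] -/
theorem s_N16_rRec₁₃CoPH_of_constLayer_leafSlot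
    (hconst : ∀ (F : T4Family) (θ : Stage13HParams F N) (hP : θ.Provisos₁₃CoPH F N) (g₀ : ℕ → ℝ) (os : List (ULoop F)) (k : ℕ), (𝔯.lit F θ hP g₀ os).ne3 k = o F)
    (h : ∀ (F : T4Family), (∃ D : Datum F N, IsDatumOfRecord₁₃CCoPH F N D) → InEndRegime (ne3OfRecord₁₁ F (o F)) ∧ LeafSlot (ne3OfRecord₁₁ F (o F))) :
    S_N16 (RRec₁₃CoPH 𝔯) :=
  (s_N16_rRec₁₃CoPH_iff_of_constLayer 𝔯 o hconst).2 fun F hF => n16At_of_inEndRegime_leafSlot (h F hF).1 (h F hF).2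

/-- **FOR A CONSTANT-LAYER READING, `S_N16 (RRec₁₃CoPHOn 𝔯 Rg)` IS ONE `N16At` PER FAMILY CARRYING A GUARDED ADMISSIBLE STAGE-13 TUPLE WITH PROVISOS** — the object `o F`
does not depend on the tuple, the couplings, the loop string or the run length, so the guarded θ-form collapses to one sentence per family. [folklore] -/
theorem s_N16_rRec₁₃CoPHOn_iff_of_constLayer
    (hconst : ∀ (F : T4Family) (θ : Stage13HParams F N) (hP : θ.Provisos₁₃CoPH F N) (g₀ : ℕ → ℝ) (os : List (ULoop F)) (k : ℕ), (𝔯.lit F θ hP g₀ os).ne3 k = o F) :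
    S_N16 (RRec₁₃CoPHOn 𝔯 Rg) ↔
      ∀ (F : T4Family), (∃ θ : Stage13HParams F N, θ.Provisos₁₃CoPH F N ∧ Rg F θ ∧ θ.Admissible F N) → N16At (ne3OfRecord₁₁ F (o F)) := by
  refine (s_N16_rRec₁₃CoPHOn_iff 𝔯 Rg).trans ⟨fun h F hF => ?_, fun h F θ hP hRg hθ g₀ os k => ?_⟩
  · obtain ⟨θ, hP, hRg, hθ⟩ := hF
    have h' := h F θ hP hRg hθ (fun _ => 0) [] 0
    rwa [hconst] at h'
  · rw [hconst]
    exact h F ⟨θ, hP, hRg, hθ⟩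

/-- **THE `h16` BINDER AT A CONSTANT LAYER, REGIME-RESTRICTED**: under the stub, `N16At (ne3OfRecord₁₁ F (o F))` at every family with a guarded admissible tuple with
provisos. [folklore] -/
theorem n16At_of_s_N16_rRec₁₃CoPHOn_constLayer
    (hconst : ∀ (F : T4Family) (θ : Stage13HParams F N) (hP : θ.Provisos₁₃CoPH F N) (g₀ : ℕ → ℝ) (os : List (ULoop F)) (k : ℕ), (𝔯.lit F θ hP g₀ os).ne3 k = o F)
    (hS : S_N16 (RRec₁₃CoPHOn 𝔯 Rg)) (F : T4Family) {θ : Stage13HParams F N} (hP : θ.Provisos₁₃CoPH F N) (hRg : Rg F θ) (hθ : θ.Admissible F N) :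
    N16At (ne3OfRecord₁₁ F (o F)) :=
  (s_N16_rRec₁₃CoPHOn_iff_of_constLayer 𝔯 Rg o hconst).1 hS F ⟨θ, hP, hRg, hθ⟩

/-- **`N16At` ONCE PER GUARDED FAMILY GIVES THE STUB** for a constant-layer reading. [folklore] -/
theorem s_N16_rRec₁₃CoPHOn_of_constLayer
    (hconst : ∀ (F : T4Family) (θ : Stage13HParams F N) (hP : θ.Provisos₁₃CoPH F N) (g₀ : ℕ → ℝ) (os : List (ULoop F)) (k : ℕ), (𝔯.lit F θ hP g₀ os).ne3 k = o F)
    (h16 : ∀ (F : T4Family), (∃ θ : Stage13HParams F N, θ.Provisos₁₃CoPH F N ∧ Rg F θ ∧ θ.Admissible F N) → N16At (ne3OfRecord₁₁ F (o F))) :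
    S_N16 (RRec₁₃CoPHOn 𝔯 Rg) :=
  (s_N16_rRec₁₃CoPHOn_iff_of_constLayer 𝔯 Rg o hconst).2 h16

/-- **THE KNIT AT A CONSTANT LAYER, REGIME-RESTRICTED, LEAF FORM**. [folklore] -/
theorem s_N16_rRec₁₃CoPHOn_of_constLayer_leafSlot
    (hconst : ∀ (F : T4Family) (θ : Stage13HParams F N) (hP : θ.Provisos₁₃CoPH F N) (g₀ : ℕ → ℝ) (os : List (ULoop F)) (k : ℕ), (𝔯.lit F θ hP g₀ os).ne3 k = o F)
    (h : ∀ (F : T4Family), (∃ θ : Stage13HParams F N, θ.Provisos₁₃CoPH F N ∧ Rg F θ ∧ θ.Admissible F N) →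
      InEndRegime (ne3OfRecord₁₁ F (o F)) ∧ LeafSlot (ne3OfRecord₁₁ F (o F))) :
    S_N16 (RRec₁₃CoPHOn 𝔯 Rg) :=
  s_N16_rRec₁₃CoPHOn_of_constLayer 𝔯 Rg o hconst fun F hF => n16At_of_inEndRegime_leafSlot (h F hF).1 (h F hF).2

/-- **THE TWO STAGE-13 HOMES AGREE AT A CONSTANT LAYER — CANONICAL ⇒ REGIME-RESTRICTED, EVERY REGIME**: `S_N16 (RRec₁₃CoPH 𝔯) → S_N16 (RRec₁₃CoPHOn 𝔯 Rg)`.  A guarded admissible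
tuple with provisos realises a Stage-13 datum of record (the (T-RATE) face `RRec₁₃CoPHOn.isDatumOfRecord₁₃CCoPH` at `rRec₁₃CoPHOn_self`), at which `n16At_of_s_N16_rRec₁₃CoPH_constLayer`
reads `N16At (ne3OfRecord₁₁ F (o F))` off the canonical home; the object being tuple-free, that is all the regime-restricted home asks. [folklore] -/
theorem s_N16_rRec₁₃CoPHOn_of_s_N16_rRec₁₃CoPH_constLayer
    (hconst : ∀ (F : T4Family) (θ : Stage13HParams F N) (hP : θ.Provisos₁₃CoPH F N) (g₀ : ℕ → ℝ) (os : List (ULoop F)) (k : ℕ), (𝔯.lit F θ hP g₀ os).ne3 k = o F)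
    (hS : S_N16 (RRec₁₃CoPH 𝔯)) : S_N16 (RRec₁₃CoPHOn 𝔯 Rg) :=
  s_N16_rRec₁₃CoPHOn_of_constLayer 𝔯 Rg o hconst fun F hF => by
    obtain ⟨θ, hP, hRg, hθ⟩ := hF
    exact n16At_of_s_N16_rRec₁₃CoPH_constLayer 𝔯 o hconst hS F (rRec₁₃CoPHOn_self 𝔯 Rg θ hP hRg hθ (fun _ => 0) [] 0).isDatumOfRecord₁₃CCoPH

/-- **… AND AT THE TRIVIAL REGIME THEY ARE EQUIVALENT FOR N16** (`S_N16 (RRec₁₃CoPHOn 𝔯 fun _ _ => True) ↔ S_N16 (RRec₁₃CoPH 𝔯)` at a constant layer). [folklore] -/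
theorem s_N16_rRec₁₃CoPHOn_true_iff_s_N16_rRec₁₃CoPH_constLayer
    (hconst : ∀ (F : T4Family) (θ : Stage13HParams F N) (hP : θ.Provisos₁₃CoPH F N) (g₀ : ℕ → ℝ) (os : List (ULoop F)) (k : ℕ), (𝔯.lit F θ hP g₀ os).ne3 k = o F) :
    S_N16 (RRec₁₃CoPHOn 𝔯 fun _ _ => True) ↔ S_N16 (RRec₁₃CoPH 𝔯) :=
  ⟨s_N16_rRec₁₃CoPH_of_rRec₁₃CoPHOn_true 𝔯, s_N16_rRec₁₃CoPHOn_of_s_N16_rRec₁₃CoPH_constLayer 𝔯 (fun _ _ => True) o hconst⟩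

end ConstLayer

/-! ## §6 At RR-1's NE3 object of record (`hpin`-generic: the named Stage-13 reading of record is one `rfl` away) -/

section OfRecord

variable (ℓ : T4Family → NE3Letters₁₁)

/-- **FOR A READING PINNED AT THE NE3 OBJECT OF RECORD, `S_N16 (RRec₁₃CoPHOn 𝔯 Rg)` IS ONE `N16At` PER GUARDED FAMILY** — at RR-1's constant layer
`ne3ConstLayerOfRecord₁₁ F N (ℓ F)` (period `2·L^m`, `dom` = all `2·L^m`-periodic `SU(N)` unit-lattice data).  `hpin` is `fun … => rfl` for a reading whose NE3 component is
`Node00.ne3ConstReadingOfRecord₁₁ F N (ℓ F)` — the Stage-13 reading of record once named (the `readingOfRecord₁₂` pattern). [folklore] -/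
theorem s_N16_rRec₁₃CoPHOn_iff_ofRecord
    (hpin : ∀ (F : T4Family) (θ : Stage13HParams F N) (hP : θ.Provisos₁₃CoPH F N) (g₀ : ℕ → ℝ) (os : List (ULoop F)) (k : ℕ),
      (𝔯.lit F θ hP g₀ os).ne3 k = ne3ConstLayerOfRecord₁₁ F N (ℓ F)) :
    S_N16 (RRec₁₃CoPHOn 𝔯 Rg) ↔ ∀ (F : T4Family), (∃ θ : Stage13HParams F N, θ.Provisos₁₃CoPH F N ∧ Rg F θ ∧ θ.Admissible F N) →
      N16At (ne3OfRecord₁₁ F (ne3ConstLayerOfRecord₁₁ F N (ℓ F))) :=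
  s_N16_rRec₁₃CoPHOn_iff_of_constLayer 𝔯 Rg (fun F => ne3ConstLayerOfRecord₁₁ F N (ℓ F)) hpin

/-- **THE KNIT AT THE OBJECT OF RECORD, REGIME-RESTRICTED, LEAF FORM**: proviso + `LeafSlot` at the one bundle of every guarded family ⇒ the stub. [folklore] -/
theorem s_N16_rRec₁₃CoPHOn_ofRecord_of_leafSlot
    (hpin : ∀ (F : T4Family) (θ : Stage13HParams F N) (hP : θ.Provisos₁₃CoPH F N) (g₀ : ℕ → ℝ) (os : List (ULoop F)) (k : ℕ),
      (𝔯.lit F θ hP g₀ os).ne3 k = ne3ConstLayerOfRecord₁₁ F N (ℓ F))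
    (h : ∀ (F : T4Family), (∃ θ : Stage13HParams F N, θ.Provisos₁₃CoPH F N ∧ Rg F θ ∧ θ.Admissible F N) →
      InEndRegime (ne3OfRecord₁₁ F (ne3ConstLayerOfRecord₁₁ F N (ℓ F))) ∧ LeafSlot (ne3OfRecord₁₁ F (ne3ConstLayerOfRecord₁₁ F N (ℓ F)))) :
    S_N16 (RRec₁₃CoPHOn 𝔯 Rg) :=
  s_N16_rRec₁₃CoPHOn_of_constLayer_leafSlot 𝔯 Rg _ hpin h

end OfRecord

/-- **THE KNIT AT THE OBJECT OF RECORD WITH LETTERS TUNED INSIDE THE TOLERANCE, REGIME-RESTRICTED — `LeafSlot` ALONE**: for a reading pinned at RR-1's constant layer with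
letters `⟨r, b F, g F, C F, r, Λ₂' F⟩`, `r = radiusOfRecord N F.L (ne3NperOfRecord₁₁ F 0 0)`, inside THE END's tolerance (`0 < g F`, `0 ≤ b F ≤ r∕2`,
`constOfRecord N F.L (ne3NperOfRecord₁₁ F 0 0) (g F) ≤ C F`), `LeafSlot` at the one bundle of every guarded family gives `S_N16 (RRec₁₃CoPHOn 𝔯 Rg)` — the proviso is file 11
v1.1's `inEndRegime_ofRecord_of_letters`.  N21's tuned `b⋆ = min (r∕2) (1∕(512·5·8·L²))` is one such choice. [folklore] -/
theorem s_N16_rRec₁₃CoPHOn_ofRecord_of_letters_of_leafSlot (g b C Λ₂' : T4Family → ℝ) (hg : ∀ F, 0 < g F) (hb₀ : ∀ F, 0 ≤ b F)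
    (hb : ∀ F : T4Family, b F ≤ radiusOfRecord N F.L (ne3NperOfRecord₁₁ F 0 0) / 2)
    (hC : ∀ F : T4Family, constOfRecord N F.L (ne3NperOfRecord₁₁ F 0 0) (g F) ≤ C F)
    (hpin : ∀ (F : T4Family) (θ : Stage13HParams F N) (hP : θ.Provisos₁₃CoPH F N) (g₀ : ℕ → ℝ) (os : List (ULoop F)) (k : ℕ),
      (𝔯.lit F θ hP g₀ os).ne3 k = ne3ConstLayerOfRecord₁₁ F N
        ⟨radiusOfRecord N F.L (ne3NperOfRecord₁₁ F 0 0), b F, g F, C F, radiusOfRecord N F.L (ne3NperOfRecord₁₁ F 0 0), Λ₂' F⟩)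
    (hslot : ∀ (F : T4Family), (∃ θ : Stage13HParams F N, θ.Provisos₁₃CoPH F N ∧ Rg F θ ∧ θ.Admissible F N) →
      LeafSlot (ne3OfRecord₁₁ F (ne3ConstLayerOfRecord₁₁ F N
        ⟨radiusOfRecord N F.L (ne3NperOfRecord₁₁ F 0 0), b F, g F, C F, radiusOfRecord N F.L (ne3NperOfRecord₁₁ F 0 0), Λ₂' F⟩))) :
    S_N16 (RRec₁₃CoPHOn 𝔯 Rg) :=
  s_N16_rRec₁₃CoPHOn_of_constLayer_leafSlot 𝔯 Rg _ hpin fun F hF =>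
    ⟨inEndRegime_ofRecord_of_letters F (hg F) (hb₀ F) (hb F) (hC F) (Λ₂' F), hslot F hF⟩

/-! ## §6b The two Stage-13 currencies agree at the object of record: the home-keyed stub `S_N16 (RRec₁₃CoPHOn 𝔯 Rg)` and the N16 conjunct of the rev-16 K3‴ skeleton's
`KeyedRates rr` at a TUPLE reading `rr` (module 21 `…N16AtTupleReadingBinderGeneric`) — both are «`N16At` at RR-1's object once per guarded family» -/

section TwoCurrencies

variable (ℓ : T4Family → NE3Letters₁₁)
  (rr : (F : T4Family) → (θ : Stage13HParams F N) → θ.Provisos₁₃CoPH F N → (ℕ → ℝ) → List (ULoop F) → RateCarriers N)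

/-- **HOME-KEYED ⟷ TUPLE-KEYED AT THE OBJECT OF RECORD**: for a layer-B reading `𝔯` and a tuple reading `rr` BOTH pinned at RR-1's constant layer with letters `ℓ F`,
`S_N16 (RRec₁₃CoPHOn 𝔯 Rg)` iff the guarded N16 conjunct of `KeyedRates rr` — §6's `s_N16_rRec₁₃CoPHOn_iff_ofRecord` and module 21's `n16_tupleReadingOn_iff_of_constLayer` have the same
right-hand side.  (E.g. `rr F θ hP g₀ os := rateCarriersOfRecord₁₃CoPH 𝔯 F θ hP g₀ os (ksel F θ g₀ os)`, both pins `rfl` at the named reading of record.) [folklore] -/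
theorem s_N16_rRec₁₃CoPHOn_iff_n16_tupleReadingOn_ofRecord
    (hpin : ∀ (F : T4Family) (θ : Stage13HParams F N) (hP : θ.Provisos₁₃CoPH F N) (g₀ : ℕ → ℝ) (os : List (ULoop F)) (k : ℕ),
      (𝔯.lit F θ hP g₀ os).ne3 k = ne3ConstLayerOfRecord₁₁ F N (ℓ F))
    (hpin' : ∀ (F : T4Family) (θ : Stage13HParams F N) (hP : θ.Provisos₁₃CoPH F N) (g₀ : ℕ → ℝ) (os : List (ULoop F)),
      (rr F θ hP g₀ os).ne3 = ne3OfRecord₁₁ F (ne3ConstLayerOfRecord₁₁ F N (ℓ F))) :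
    S_N16 (RRec₁₃CoPHOn 𝔯 Rg) ↔ ∀ (F : T4Family) (θ : Stage13HParams F N) (hP : θ.Provisos₁₃CoPH F N), Rg F θ → θ.Admissible F N →
      ∀ (g₀ : ℕ → ℝ) (os : List (ULoop F)), N16At (rr F θ hP g₀ os).ne3 :=
  (s_N16_rRec₁₃CoPHOn_iff_ofRecord 𝔯 Rg ℓ hpin).trans
    (N16AtTupleReadingBinderGeneric.n16_tupleReadingOn_iff_of_constLayer rr Rg (fun F => ne3ConstLayerOfRecord₁₁ F N (ℓ F)) hpin').symm

/-- **THE SAME AT THE CANONICAL HOME, UNGUARDED** (the K3‴ skeleton's own binder shape): `S_N16 (RRec₁₃CoPH 𝔯)` iff the N16 conjunct of `KeyedRates rr` — a family carries a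
Stage-13 datum of record iff it carries an admissible tuple with provisos (RR-2's `exists_isDatumOfRecord₁₃CCoPH_iff_exists_params`). [folklore] -/
theorem s_N16_rRec₁₃CoPH_iff_n16_tupleReading_ofRecord
    (hpin : ∀ (F : T4Family) (θ : Stage13HParams F N) (hP : θ.Provisos₁₃CoPH F N) (g₀ : ℕ → ℝ) (os : List (ULoop F)) (k : ℕ),
      (𝔯.lit F θ hP g₀ os).ne3 k = ne3ConstLayerOfRecord₁₁ F N (ℓ F))
    (hpin' : ∀ (F : T4Family) (θ : Stage13HParams F N) (hP : θ.Provisos₁₃CoPH F N) (g₀ : ℕ → ℝ) (os : List (ULoop F)),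
      (rr F θ hP g₀ os).ne3 = ne3OfRecord₁₁ F (ne3ConstLayerOfRecord₁₁ F N (ℓ F))) :
    S_N16 (RRec₁₃CoPH 𝔯) ↔ ∀ (F : T4Family) (θ : Stage13HParams F N) (hP : θ.Provisos₁₃CoPH F N), θ.Admissible F N →
      ∀ (g₀ : ℕ → ℝ) (os : List (ULoop F)), N16At (rr F θ hP g₀ os).ne3 := by
  refine (s_N16_rRec₁₃CoPH_iff_of_constLayer 𝔯 (fun F => ne3ConstLayerOfRecord₁₁ F N (ℓ F)) hpin).trans
    (Iff.trans ?_ (N16AtTupleReadingBinderGeneric.n16_tupleReading_iff_of_constLayer rr (fun F => ne3ConstLayerOfRecord₁₁ F N (ℓ F)) hpin').symm)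
  refine forall_congr' fun F => ⟨fun h ⟨θ, hP, hθ⟩ => h ⟨_, Node00.isDatumOfRecord₁₃CCoPH_datumOfRecord₁₃CoPH F N θ hP hθ⟩, fun h ⟨D, hD⟩ => ?_⟩
  exact h ⟨hD.params, hD.provisos, hD.admissible⟩

end TwoCurrencies

/-! ## §7 (‴ only) The junk tests of the ‴ module §7 (`s_N16_rRec₁₃On_of_flatReading`, `exists_reading₁₃_ne3_const`, `not_s_N16_rRec₁₃On_of_negLipReading`,
`exists_reading_not_s_N16_rRec₁₃On`) transfer to the CoPH homes with the same proofs; not re-typed here (400-line cap). -/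

end

end Summit.QuantumFields.YangMills.BalabanUVNodes.N16AtRRec13CoPH
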